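import Summits.QuantumFields.BalabanUV.Beta.FP.PerfectFullSandwich
import Literature.MathematicalPhysics.QuantumFieldTheory.Balaban1983to89.B14DeltaBeta

/-!
# `BalabanUV.Beta.FP.BiVertexSlotLetters` — road «FP» for binder row D1, `RESIDUAL-FP.md` §9 ROW #14 LETTERS (leaf-01, gen 13): THE BI-VERTEX SLOT's `Loc`
# AND `MomentSummable` LETTERS FOLLOW FROM THE JET LETTERS (row #4) — the binders `hloc₀`∕`hs₀` of the owner's ONE theorem
# `RoadLeftAssembly.d1Drift_left_of_sliceLedger` DERIVED from its own `hSp`∕`hWf` and the tree's K-letter `StepLawKHolds.exists_decays_KPerf_holds`;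
# and the EXTRA slot's `hlocx`∕`hsx` from ONE `VertexFamily₂` letter of `Wx m` (the currency of rows (G8)∕(G-mix-W))

HONEST DEPENDENCY (page 1, mandatory): continuum YM on T⁴ ⇐ BetaPertH ∧ nine spine estimates (0/9 proved); BetaPertH ⇐ (D1) ∧ (D4) ∧
CAP+tail; G-an2-4 gates asym, D1 and NE2/3/4.  HONEST FRAMING (cell contract, verbatim): «discharging `BetaPertH` makes Bałaban's UV
stability UNCONDITIONAL — a real constructive-QFT result; it is NOT the continuum limit and NOT the Clay problem.»  THIS MODULE is [folklore]
localisation∕summability bookkeeping (§1–§3) + [our object] COMPOSITION BY NAME (§4); no `def`, no `def … : Prop`, nothing cited, nothing of the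
manuscripts under audit asserted, 0 sorry; no existing file touched.  It discharges NO estimate of Bałaban's constrained objects: the two letters it removes
from the displayed list of `d1Drift_left_of_sliceLedger` (`hloc₀`: localisation of the `(μ,0;ν,z)` members of the bi-vertex slot `vertex2OfK (KPerf m) (Lc^m) (Wf m)`;
`hs₀`: (1.22)-summability of the LEFT bi-vertex kernel in the channel `(μ,ν)`) were never estimates — they follow from the SAME theorem's row-#4 jet letters
`hSp`∕`hWf` (which STAY displayed: X1m-S∕W rows EXT + finite-`j` covariance) and the perfect resolvent's decay (gan24's `convCKWall_holds` through
`exists_decays_KPerf_holds`).  NOT `hlocx`∕`hsx`∕`hextra` (the EXTRA slot `Wx m` — rows (G8)∕(G-mix-W), EXT), NOT row #4 for the literal, NOT COPROJ₂-SYM,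
NOT hsplit, NOT (ASYMP) proved, NOT D1; 0∕4 row-D1 binders; NOT BetaPertH, NOT continuum, NOT Clay.  «not in print; our bookkeeping».

ABSOLUTE RULE (cell charter, verbatim): «No internally-minted statement may enter as a cited fact. Every hypothesis is either kernel-proved in this
package or a verbatim quotation of a PUBLISHED theorem with page reference. The manuscript(s) under audit are NOT citable for their own disputed
steps — they are the thing under adjudication; programme-internal (2001/route/tribunal) claims are never citable.»

CONTENT.  §1 [folklore] `b14MomentSummable_of_absMoment₂`∕`_of_decay510`∕`_of_hdec` — the bridge between the tree's two summability currencies: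
`DecimatedMomentSummable.AbsMoment₂ (P μ ν)` (fed by every (5.10)-type decay, `absMoment₂_of_decay510`) ⟹ `B14DeltaBeta.MomentSummable P μ ν` (the hypothesis
of `B14DeltaBeta.secondMoment_add`), by `|z_μ z_ν| ≤ 1 + |z|₁²`.  §2 [folklore] `biLoc_innerVertex_of_biLoc`, `vertexFamily₂_vertex2OfK_of_biLoc`,
`loc_vertex2OfK_of_biLoc` — the bi-vertex `vertex2OfK K N Wf` of a decaying `K` and a bi-table family in the (LEDGER) skeleton's currency
`∀ κ′ u l′ u′, BiLoc (Wf κ′ u l′ u′) u u′ C2 δ2` (legs at the TWO fine bonds — NOT `LocStencil₂`) is a `VertexFamily₂` at blocking `N`, explicit constant, rate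
`min δ δ2 ∕ 4` (`DressedTadpoleTable.biLoc_wsum_snd∕fst` per `(κ′, λ′)`).  §3 [folklore] `hdec_hessKer_left`, `absMoment₂_hessKer_left`, `b14MomentSummable_hessKer_left`
— decay and summability of every channel of the LEFT kernel `hessKer K (vertexOfK K N S) (vertex2OfK K N Wf)` from `Decays K`, `LocStencil S`, the letter of `Wf`,
`1 ≤ N`; `hdec_halfTadpole_of_vertexFamily₂`, `b14MomentSummable_halfTadpole_of_vertexFamily₂` — the same for the EXTRA slot's coarse piece
`z ↦ ½·tadpole K (Wx μ 0 ν z)` (= `hessKer K 0 Wx`, `PerfectBubbleExpansion.hessKer_zero_V`) from `VertexFamily₂ Wx N Cx δx`.  §4 [our object] at `K := KPerf … m`,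
`N := Lc^m` (`2 ≤ Lc`, `m ≥ 1`), ANY families `S m`∕`Wf m`∕`Wx m`: `hloc₀_of_jetLetters`, `hs₀_of_jetLetters` — VERBATIM the binders `hloc₀`∕`hs₀` from the END's
letters `hSp`∕`hWf`; `hlocx_of_extraLetter`, `hsx_of_extraLetter` — VERBATIM the binders `hlocx`∕`hsx` from ONE letter `∃ Cx δx > 0, VertexFamily₂ (Wx m) (Lc^m) Cx δx`
per `m`.  The END with the four binders re-wired is the sequel `FP/RoadLeftAssemblyLetters.lean`.
Provenance: D1 formalisation swarm LEAF PROVER 01, unit `b2b-balaban-beta-d1-formalise-leaf-01` gen 13, 2026-08-21, road FP row #14 letters (INTENT CLAIMS l.29391).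
-/

noncomputable section

namespace Summit.QuantumFields.BalabanUV.Beta.FP.BiVertexSlotLetters

open Literature.MathematicalPhysics.QuantumFieldTheory.Balaban1983to89
open Literature.MathematicalPhysics.QuantumFieldTheory.Balaban1983to89.Beta
open B12Sec2to5 (l1 l1_nonneg Decay510)
open ExpKernelCalculus (Site MKer Decays BiLoc shiftK tadpole hessKer VertexFamily VertexFamily₂ Zl Zl_nonneg)
open DecimatedMomentSummable (AbsMoment₂ absMoment₂_of_decay510 abs_le_of_isMoment₂ IsMoment₂)
open OneStepResolventKernel (Fib wsum LocStencil biLoc_mono)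
open OneStepKernelFamily (colH vertexOfK abs_colH_le vertexFamily_vertexOfK' hdec_hessKer_of_decays)
open SecondOrderResponse (vertex2OfK)
open Summit.QuantumFields.BalabanUV.Beta.TameKernelCalculus (Loc biLoc_of_le)
open Summit.QuantumFields.BalabanUV.Beta.GAN24.CombesThomas (sfStep smStep)
open Summit.QuantumFields.BalabanUV.Beta.D1BFx.DressedBubbleBridge (expWeight_of_le)
open Summit.QuantumFields.BalabanUV.Beta.D1BFx.DressedTadpoleTable (biLoc_wsum_snd biLoc_wsum_fst)
open Summit.QuantumFields.BalabanUV.Beta.FP.PerfectObjectsT (KPerf SPerfOf)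
open Summit.QuantumFields.BalabanUV.Beta.FP.StepLawKHolds (exists_decays_KPerf_holds)

/-! ## §1 The bridge between the two summability currencies: `AbsMoment₂` ⟹ (1.22)-summability -/
section Bridge
variable {D : ℕ}

/-- [folklore] **(1.22)-SUMMABILITY FROM AN ABSOLUTELY SUMMABLE SECOND MOMENT**: `Σ_z (1+|z|₁²)|P μ ν z| < ∞` ⟹ `Σ_z P μ ν z·z_μ·z_ν` summable
(`B14DeltaBeta.MomentSummable P μ ν`), since `|z_μ·z_ν| ≤ 1 + |z|₁²` (`DecimatedMomentSummable.abs_le_of_isMoment₂`, letter `coord2 μ ν`). -/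
theorem b14MomentSummable_of_absMoment₂ {P : B12Beta.Kernel D} {μ ν : Fin D} (h : AbsMoment₂ (P μ ν)) :
    B14DeltaBeta.MomentSummable P μ ν := by
  unfold B14DeltaBeta.MomentSummable
  refine Summable.of_norm_bounded h (fun z => ?_)
  have hm : |(z μ : ℝ) * (z ν : ℝ)| ≤ 1 + l1 z ^ 2 := by simpa [Int.cast_mul] using abs_le_of_isMoment₂ (IsMoment₂.coord2 μ ν) z
  rw [Real.norm_eq_abs, mul_assoc, abs_mul, mul_comm]
  exact mul_le_mul_of_nonneg_right hm (abs_nonneg _)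

/-- [folklore] **(1.22)-SUMMABILITY FROM (5.10)-TYPE DECAY** of the channel: `Decay510 (P μ ν) C δ₁`, `0 < δ₁` ⟹ `B14DeltaBeta.MomentSummable P μ ν`. -/
theorem b14MomentSummable_of_decay510 {P : B12Beta.Kernel D} {μ ν : Fin D} {C δ₁ : ℝ} (hδ : 0 < δ₁) (h : Decay510 (P μ ν) C δ₁) :
    B14DeltaBeta.MomentSummable P μ ν :=
  b14MomentSummable_of_absMoment₂ (absMoment₂_of_decay510 hδ h)

/-- [folklore] Uniform form: a (5.10)-type decay of every channel gives (1.22)-summability of every channel. -/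
theorem b14MomentSummable_of_hdec {P : B12Beta.Kernel D} (h : ∃ C δ₁ : ℝ, 0 < δ₁ ∧ ∀ μ ν : Fin D, Decay510 (P μ ν) C δ₁) (μ ν : Fin D) :
    B14DeltaBeta.MomentSummable P μ ν := by
  obtain ⟨C, δ₁, hδ, h⟩ := h
  exact b14MomentSummable_of_decay510 hδ (h μ ν)

end Bridge

/-! ## §2 The bi-vertex of a bi-table family in the skeleton's `(u, u′)` currency is a second-order vertex family -/
section BiVertex
variable {d N : ℕ} {K : MKer (d + 1) (Fib d)} {C δ : ℝ}
  {Wf : Fin (d + 1) → (Fin (d + 1) → ℤ) → Fin (d + 1) → (Fin (d + 1) → ℤ) → MKer (d + 1) (Fib d)} {C2 δ2 : ℝ}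

/-- [folklore] **THE INNER FIELD-COLUMN VERTEX OF A SLICE, `(u, u′)` CURRENCY**: `Decays K C δ`, `BiLoc (Wf κ′ u λ′ u′) u u′ C2 δ2` (all indices) ⟹ for every
`(κ′, u)` the inner vertex `vertexOfK K N (Wf κ′ u) ν y′` is bi-localised at `(u, N•y′)` with constant `(d+1)·(C·C2·Zl(δ′∕2))` and rate `δ′∕2`,
`δ′ := min δ δ2` (`biLoc_wsum_snd` per `λ′`, then the finite sum over `λ′`). -/
theorem biLoc_innerVertex_of_biLoc (hK : Decays K C δ) (hδ : 0 < δ) (hW : ∀ κ' u l' u', BiLoc (Wf κ' u l' u') u u' C2 δ2) (hδ2 : 0 < δ2)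
    (κ' : Fin (d + 1)) (u : Fin (d + 1) → ℤ) (ν : Fin (d + 1)) (y' : Fin (d + 1) → ℤ) :
    BiLoc (vertexOfK K N (Wf κ' u) ν y') u ((N : ℤ) • y') ((d + 1 : ℕ) * (C * |C2| * Zl (d + 1) (min δ δ2 / 2))) (min δ δ2 / 2) := by
  have hC : 0 ≤ C := hK.nonneg (Sum.inl 0)
  have hm : 0 < min δ δ2 := lt_min hδ hδ2
  have hterm : ∀ l' : Fin (d + 1), BiLoc (wsum (colH K N ν y' l') (Wf κ' u l')) u ((N : ℤ) • y')
      (C * |C2| * Zl (d + 1) (min δ δ2 / 2)) (min δ δ2 / 2) := fun l' =>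
    biLoc_wsum_snd (fun u' => expWeight_of_le (fun u'' => abs_colH_le (N := N) hK ν y' l' u'') hC (min_le_left _ _) u')
      (fun u' => biLoc_of_le (hW κ' u l' u') (min_le_right _ _)) hm hC
  have hsum := KernelWard.biLoc_finset_sum (Finset.univ : Finset (Fin (d + 1))) (fun l' _ => hterm l')
  simp only [Finset.sum_const, Finset.card_univ, Fintype.card_fin, nsmul_eq_mul] at hsum
  have e : vertexOfK K N (Wf κ' u) ν y' = ∑ i : Fin (d + 1), wsum (colH K N ν y' i) (Wf κ' u i) := by
    funext x z a b; simp only [Finset.sum_apply]; rfl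
  rw [e]; exact hsum

/-- [folklore] **THE BI-VERTEX IN THE `(u, u′)` CURRENCY IS A SECOND-ORDER VERTEX FAMILY** (the (LEDGER) skeleton's twin of
`SecondOrderResponse.vertexFamily₂_vertex2OfK`, which asks `LocStencil₂`): `Decays K C δ`, `0 < δ`, `∀ κ′ u λ′ u′, BiLoc (Wf κ′ u λ′ u′) u u′ C2 δ2`, `0 < δ2` ⟹
`VertexFamily₂ (vertex2OfK K N Wf) N ((d+1)·(C·((d+1)·(C·|C2|·Zl(δ′∕2)))·Zl(δ′∕4))) (δ′∕4)`, `δ′ := min δ δ2` (`biLoc_wsum_fst` per `κ′` over §2's inner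
vertices, then the finite sum over `κ′`). -/
theorem vertexFamily₂_vertex2OfK_of_biLoc (hK : Decays K C δ) (hδ : 0 < δ) (hW : ∀ κ' u l' u', BiLoc (Wf κ' u l' u') u u' C2 δ2) (hδ2 : 0 < δ2) :
    VertexFamily₂ (vertex2OfK K N Wf) N
      ((d + 1 : ℕ) * (C * ((d + 1 : ℕ) * (C * |C2| * Zl (d + 1) (min δ δ2 / 2))) * Zl (d + 1) (min δ δ2 / 2 / 2))) (min δ δ2 / 2 / 2) := by
  intro μ y ν y'
  have hC : 0 ≤ C := hK.nonneg (Sum.inl 0)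
  have hm : 0 < min δ δ2 / 2 := half_pos (lt_min hδ hδ2)
  have hle : min δ δ2 / 2 ≤ δ := (half_le_self (lt_min hδ hδ2).le).trans (min_le_left _ _)
  have hterm : ∀ κ' : Fin (d + 1), BiLoc (wsum (colH K N μ y κ') (fun u => vertexOfK K N (Wf κ' u) ν y')) ((N : ℤ) • y) ((N : ℤ) • y')
      (C * ((d + 1 : ℕ) * (C * |C2| * Zl (d + 1) (min δ δ2 / 2))) * Zl (d + 1) (min δ δ2 / 2 / 2)) (min δ δ2 / 2 / 2) := fun κ' =>
    biLoc_wsum_fst (fun u => expWeight_of_le (fun u'' => abs_colH_le (N := N) hK μ y κ' u'') hC hle u)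
      (fun u => biLoc_innerVertex_of_biLoc (N := N) hK hδ hW hδ2 κ' u ν y') hm hC
  have hsum := KernelWard.biLoc_finset_sum (Finset.univ : Finset (Fin (d + 1))) (fun κ' _ => hterm κ')
  simp only [Finset.sum_const, Finset.card_univ, Fintype.card_fin, nsmul_eq_mul] at hsum
  have e : vertex2OfK K N Wf μ y ν y' = ∑ i : Fin (d + 1), wsum (colH K N μ y i) (fun u => vertexOfK K N (Wf i u) ν y') := by
    funext x z a b; simp only [Finset.sum_apply]; rfl
  rw [e]; exact hsum

/-- [folklore] **EVERY MEMBER OF THE BI-VERTEX SLOT IS LOCALISED**: `Loc (vertex2OfK K N Wf μ y ν y′)` — in particular the `(μ,0;ν,z)` members asked by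
the W-split row. -/
theorem loc_vertex2OfK_of_biLoc (hK : Decays K C δ) (hδ : 0 < δ) (hW : ∀ κ' u l' u', BiLoc (Wf κ' u l' u') u u' C2 δ2) (hδ2 : 0 < δ2)
    (μ : Fin (d + 1)) (y : Fin (d + 1) → ℤ) (ν : Fin (d + 1)) (y' : Fin (d + 1) → ℤ) : Loc (vertex2OfK K N Wf μ y ν y') :=
  ⟨(N : ℤ) • y, (N : ℤ) • y', _, _, half_pos (half_pos (lt_min hδ hδ2)), vertexFamily₂_vertex2OfK_of_biLoc hK hδ hW hδ2 μ y ν y'⟩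

end BiVertex

/-! ## §3 Decay and summability of the LEFT bi-vertex kernel from the letters -/
section Left
variable {d N : ℕ} {K : MKer (d + 1) (Fib d)} {C δ : ℝ}
  {S : Fin (d + 1) → (Fin (d + 1) → ℤ) → MKer (d + 1) (Fib d)} {Cs δs : ℝ}
  {Wf : Fin (d + 1) → (Fin (d + 1) → ℤ) → Fin (d + 1) → (Fin (d + 1) → ℤ) → MKer (d + 1) (Fib d)} {C2 δ2 : ℝ}

/-- [folklore] **(5.10)-TYPE DECAY OF THE LEFT BI-VERTEX KERNEL**: `Decays K C δ`, `LocStencil S Cs δs`, the `(u,u′)` letter of `Wf`, `1 ≤ N` ⟹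
`∃ C′ δ′ > 0, ∀ μ ν, Decay510 (hessKer K (vertexOfK K N S) (vertex2OfK K N Wf) μ ν) C′ δ′` (`hdec_hessKer_of_decays` ∘ `vertexFamily_vertexOfK′` ∘ §2, rates
matched by monotonicity). -/
theorem hdec_hessKer_left (hK : Decays K C δ) (hδ : 0 < δ) (hS : LocStencil S Cs δs) (hδs : 0 < δs)
    (hW : ∀ κ' u l' u', BiLoc (Wf κ' u l' u') u u' C2 δ2) (hδ2 : 0 < δ2) (hN : 1 ≤ N) :
    ∃ C' δ' : ℝ, 0 < δ' ∧ ∀ μ ν : Fin (d + 1), Decay510 (hessKer K (vertexOfK K N S) (vertex2OfK K N Wf) μ ν) C' δ' := by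
  have hC : 0 ≤ C := hK.nonneg (Sum.inl 0)
  obtain ⟨Cv, δv, hδv, hV⟩ := vertexFamily_vertexOfK' (N := N) ⟨δ, C, hδ, hC, hK⟩ hS hδs
  have hWv := vertexFamily₂_vertex2OfK_of_biLoc (N := N) hK hδ hW hδ2
  have hδw : 0 < min δ δ2 / 2 / 2 := half_pos (half_pos (lt_min hδ hδ2))
  have hV' : VertexFamily (vertexOfK K N S) N Cv (min δv (min δ δ2 / 2 / 2)) := fun μ y =>
    biLoc_mono (hV μ y) ((hV 0 0).nonneg (Sum.inl 0)) (min_le_left _ _)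
  have hW' : VertexFamily₂ (vertex2OfK K N Wf) N _ (min δv (min δ δ2 / 2 / 2)) := fun μ y ν y' =>
    biLoc_mono (hWv μ y ν y') ((hWv 0 0 0 0).nonneg (Sum.inl 0)) (min_le_right _ _)
  exact hdec_hessKer_of_decays ⟨δ, C, hδ, hC, hK⟩ hV' hW' (lt_min hδv hδw) hN

/-- [folklore] `AbsMoment₂` of every channel of the LEFT bi-vertex kernel, same data. -/
theorem absMoment₂_hessKer_left (hK : Decays K C δ) (hδ : 0 < δ) (hS : LocStencil S Cs δs) (hδs : 0 < δs)
    (hW : ∀ κ' u l' u', BiLoc (Wf κ' u l' u') u u' C2 δ2) (hδ2 : 0 < δ2) (hN : 1 ≤ N) (μ ν : Fin (d + 1)) :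
    AbsMoment₂ (hessKer K (vertexOfK K N S) (vertex2OfK K N Wf) μ ν) := by
  obtain ⟨C', δ', hδ', h⟩ := hdec_hessKer_left (N := N) hK hδ hS hδs hW hδ2 hN
  exact absMoment₂_of_decay510 hδ' (h μ ν)

/-- [folklore] **(1.22)-SUMMABILITY OF EVERY CHANNEL OF THE LEFT BI-VERTEX KERNEL**, same data (§1 ∘ `hdec_hessKer_left`). -/
theorem b14MomentSummable_hessKer_left (hK : Decays K C δ) (hδ : 0 < δ) (hS : LocStencil S Cs δs) (hδs : 0 < δs)
    (hW : ∀ κ' u l' u', BiLoc (Wf κ' u l' u') u u' C2 δ2) (hδ2 : 0 < δ2) (hN : 1 ≤ N) (μ ν : Fin (d + 1)) :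
    B14DeltaBeta.MomentSummable (hessKer K (vertexOfK K N S) (vertex2OfK K N Wf)) μ ν :=
  b14MomentSummable_of_hdec (hdec_hessKer_left (N := N) hK hδ hS hδs hW hδ2 hN) μ ν

end Left

/-! ## §3b The EXTRA slot's coarse piece `½·tadpole K (Wx μ 0 ν z)` from a `VertexFamily₂` letter -/
section Extra
variable {d N : ℕ} {K : MKer (d + 1) (Fib d)} {C δ : ℝ}
  {Wx : Fin (d + 1) → (Fin (d + 1) → ℤ) → Fin (d + 1) → (Fin (d + 1) → ℤ) → MKer (d + 1) (Fib d)} {Cx δx : ℝ}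

/-- [folklore] **(5.10)-TYPE DECAY OF THE EXTRA SLOT's COARSE PIECE**: `Decays K C δ`, `VertexFamily₂ Wx N Cx δx`, `1 ≤ N` ⟹
`∃ C′ δ′ > 0, ∀ μ ν, Decay510 (z ↦ ½·tadpole K (Wx μ 0 ν z)) C′ δ′` — the piece IS `hessKer K 0 Wx μ ν` (`PerfectBubbleExpansion.hessKer_zero_V`), so
`hdec_hessKer_of_decays` with the zero vertex family applies. -/
theorem hdec_halfTadpole_of_vertexFamily₂ (hK : Decays K C δ) (hδ : 0 < δ) (hWx : VertexFamily₂ Wx N Cx δx) (hδx : 0 < δx) (hN : 1 ≤ N) :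
    ∃ C' δ' : ℝ, 0 < δ' ∧ ∀ μ ν : Fin (d + 1), Decay510 (fun z => (1 / 2 : ℝ) * tadpole K (Wx μ 0 ν z)) C' δ' := by
  have hC : 0 ≤ C := hK.nonneg (Sum.inl 0)
  obtain ⟨C', δ', hδ', h⟩ := hdec_hessKer_of_decays (N := N) ⟨δ, C, hδ, hC, hK⟩ (PerfectBubbleExpansion.vertexFamily_zero N δx) hWx hδx hN
  exact ⟨C', δ', hδ', fun μ ν x => by simpa only [PerfectBubbleExpansion.hessKer_zero_V] using h μ ν x⟩

/-- [folklore] **(1.22)-SUMMABILITY OF THE EXTRA SLOT's COARSE PIECE** in every channel, same data. -/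
theorem b14MomentSummable_halfTadpole_of_vertexFamily₂ (hK : Decays K C δ) (hδ : 0 < δ) (hWx : VertexFamily₂ Wx N Cx δx) (hδx : 0 < δx)
    (hN : 1 ≤ N) (μ ν : Fin (d + 1)) :
    B14DeltaBeta.MomentSummable (fun μ' ν' z => (1 / 2 : ℝ) * tadpole K (Wx μ' 0 ν' z)) μ ν :=
  b14MomentSummable_of_hdec (P := fun μ' ν' z => (1 / 2 : ℝ) * tadpole K (Wx μ' 0 ν' z))
    (hdec_halfTadpole_of_vertexFamily₂ (N := N) hK hδ hWx hδx hN) μ ν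

end Extra

/-! ## §4 At the road's objects: the binders `hloc₀`∕`hs₀` of the END from its jet letters, `hlocx`∕`hsx` from one `VertexFamily₂` letter -/
section Road
variable {Lc : ℕ} [NeZero Lc]

/-- [our object] **THE BINDER `hloc₀` OF `d1Drift_left_of_sliceLedger` FROM ITS `hWf`**: for every `m ≥ 1` and every `z`,
`Loc (vertex2OfK (KPerf … m) (Lc^m) (Wf m) μ 0 ν z)` — the perfect resolvent decays (`exists_decays_KPerf_holds`, `2 ≤ Lc`) and `Wf m` carries the
`(u,u′)` letter (the covariance conjunct of `hWf` is not used). -/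
theorem hloc₀_of_jetLetters (hLc : 2 ≤ Lc)
    {Wf : ℕ → Fin (3 + 1) → (Fin (3 + 1) → ℤ) → Fin (3 + 1) → (Fin (3 + 1) → ℤ) → MKer (3 + 1) (Fib 3)}
    (hWf : ∀ m : ℕ, 1 ≤ m → ∃ C2 δ2 : ℝ, 0 < δ2 ∧ (∀ κ' u l' u', BiLoc (Wf m κ' u l' u') u u' C2 δ2) ∧
      ∀ κ' u l' u' t, Wf m κ' (u + ((Lc ^ m : ℕ) : ℤ) • t) l' (u' + ((Lc ^ m : ℕ) : ℤ) • t)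
        = shiftK (-(((Lc ^ m : ℕ) : ℤ) • t)) (Wf m κ' u l' u'))
    (μ ν : Fin (3 + 1)) :
    ∀ m : ℕ, 1 ≤ m → ∀ z, Loc (vertex2OfK (KPerf (d := 3) Lc (sfStep Lc) (smStep 3 Lc) m) (Lc ^ m) (Wf m) μ 0 ν z) := by
  intro m hm z
  obtain ⟨CK, δK, hδK, hK⟩ := exists_decays_KPerf_holds hLc hm
  obtain ⟨C2, δ2, hδ2, hW, -⟩ := hWf m hm
  exact loc_vertex2OfK_of_biLoc hK hδK hW hδ2 μ 0 ν z

/-- [our object] **THE BINDER `hs₀` OF `d1Drift_left_of_sliceLedger` FROM ITS `hSp` AND `hWf`**: for every `m ≥ 1`, (1.22)-summability in the channel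
`(μ, ν)` of the LEFT bi-vertex kernel `hessKer (KPerf m) (vertexOfK (KPerf m) (Lc^m) (S m)) (vertex2OfK (KPerf m) (Lc^m) (Wf m))` — ANY stencil family `S m`
with the letter `hSp` (at the road: `S m := SPerfOf (sfStep Lc) (smStep 3 Lc) S₀ m`) and ANY bi-table family `Wf m` with the letter `hWf` (covariance conjuncts
unused). -/
theorem hs₀_of_jetLetters (hLc : 2 ≤ Lc)
    (S : ℕ → Fin (3 + 1) → (Fin (3 + 1) → ℤ) → MKer (3 + 1) (Fib 3))
    (hSp : ∀ m : ℕ, 1 ≤ m → ∃ Cs δs : ℝ, 0 < δs ∧ LocStencil (S m) Cs δs ∧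
      ∀ κ u t, S m κ (u + ((Lc ^ m : ℕ) : ℤ) • t) = shiftK (-(((Lc ^ m : ℕ) : ℤ) • t)) (S m κ u))
    {Wf : ℕ → Fin (3 + 1) → (Fin (3 + 1) → ℤ) → Fin (3 + 1) → (Fin (3 + 1) → ℤ) → MKer (3 + 1) (Fib 3)}
    (hWf : ∀ m : ℕ, 1 ≤ m → ∃ C2 δ2 : ℝ, 0 < δ2 ∧ (∀ κ' u l' u', BiLoc (Wf m κ' u l' u') u u' C2 δ2) ∧
      ∀ κ' u l' u' t, Wf m κ' (u + ((Lc ^ m : ℕ) : ℤ) • t) l' (u' + ((Lc ^ m : ℕ) : ℤ) • t)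
        = shiftK (-(((Lc ^ m : ℕ) : ℤ) • t)) (Wf m κ' u l' u'))
    (μ ν : Fin (3 + 1)) :
    ∀ m : ℕ, 1 ≤ m → B14DeltaBeta.MomentSummable
      (hessKer (KPerf (d := 3) Lc (sfStep Lc) (smStep 3 Lc) m)
        (vertexOfK (KPerf (d := 3) Lc (sfStep Lc) (smStep 3 Lc) m) (Lc ^ m) (S m))
        (vertex2OfK (KPerf (d := 3) Lc (sfStep Lc) (smStep 3 Lc) m) (Lc ^ m) (Wf m))) μ ν := by
  intro m hm
  have hn : 1 ≤ Lc ^ m := Nat.one_le_pow _ _ (by omega)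
  obtain ⟨CK, δK, hδK, hK⟩ := exists_decays_KPerf_holds hLc hm
  obtain ⟨Cs, δs, hδs, hS, -⟩ := hSp m hm
  obtain ⟨C2, δ2, hδ2, hW, -⟩ := hWf m hm
  exact b14MomentSummable_hessKer_left hK hδK hS hδs hW hδ2 hn μ ν

omit [NeZero Lc] in
/-- [our object] **THE BINDER `hlocx` OF `d1Drift_left_of_sliceLedger` FROM ONE `VertexFamily₂` LETTER OF THE EXTRA SLOT**: for every `m ≥ 1` and `z`,
`Loc (Wx m μ 0 ν z)` — immediate from `VertexFamily₂ (Wx m) (Lc^m) Cx δx` (the currency in which rows (G8)∕(G-mix-W) ∕ `BiVertexLimit` deliver the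
response∕mixed∕`dM` summands: `SecondOrderResponse.vertexFamily₂_resp`, `…_mixOfK`). -/
theorem hlocx_of_extraLetter
    {Wx : ℕ → Fin (3 + 1) → (Fin (3 + 1) → ℤ) → Fin (3 + 1) → (Fin (3 + 1) → ℤ) → MKer (3 + 1) (Fib 3)}
    (hWx : ∀ m : ℕ, 1 ≤ m → ∃ Cx δx : ℝ, 0 < δx ∧ VertexFamily₂ (Wx m) (Lc ^ m) Cx δx) (μ ν : Fin (3 + 1)) :
    ∀ m : ℕ, 1 ≤ m → ∀ z, Loc (Wx m μ 0 ν z) := by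
  intro m hm z
  obtain ⟨Cx, δx, hδx, h⟩ := hWx m hm
  exact ⟨_, _, Cx, δx, hδx, h μ 0 ν z⟩

/-- [our object] **THE BINDER `hsx` OF `d1Drift_left_of_sliceLedger` FROM THE SAME LETTER**: for every `m ≥ 1`, (1.22)-summability in the channel `(μ, ν)` of
the extra coarse piece `z ↦ ½·tadpole (KPerf … m) (Wx m μ′ 0 ν′ z)` (`exists_decays_KPerf_holds` + §3b). -/
theorem hsx_of_extraLetter (hLc : 2 ≤ Lc)
    {Wx : ℕ → Fin (3 + 1) → (Fin (3 + 1) → ℤ) → Fin (3 + 1) → (Fin (3 + 1) → ℤ) → MKer (3 + 1) (Fib 3)}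
    (hWx : ∀ m : ℕ, 1 ≤ m → ∃ Cx δx : ℝ, 0 < δx ∧ VertexFamily₂ (Wx m) (Lc ^ m) Cx δx) (μ ν : Fin (3 + 1)) :
    ∀ m : ℕ, 1 ≤ m → B14DeltaBeta.MomentSummable
      (fun μ' ν' z => (1 / 2 : ℝ) * tadpole (KPerf (d := 3) Lc (sfStep Lc) (smStep 3 Lc) m) (Wx m μ' 0 ν' z)) μ ν := by
  intro m hm
  have hn : 1 ≤ Lc ^ m := Nat.one_le_pow _ _ (by omega)
  obtain ⟨CK, δK, hδK, hK⟩ := exists_decays_KPerf_holds hLc hm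
  obtain ⟨Cx, δx, hδx, h⟩ := hWx m hm
  exact b14MomentSummable_halfTadpole_of_vertexFamily₂ hK hδK h hδx hn μ ν

end Road

end Summit.QuantumFields.BalabanUV.Beta.FP.BiVertexSlotLetters

end
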